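/-
Origin: expansion seat `planner-pub-hodgecm-pv08-g3-0`, handover #3 2026-08-18T05:45:08Z (`HOME/pub-hodgecm-pv08-g3/lean/Pv08g3/S4ModelSeparation.lean`, md5 212ff3f6, 161 lines);
landed by the gen-6 packager in gate run 23 as `HodgeCM/PerL34/S4ModelSeparation.lean` (import ^import Pv[0-9]+g[0-9]+\.→import HodgeCM.PerL34. ×1).
-/
/-
pub-hodgecm cell — DAG-NODE PROVER #08 gen 3 (session planner-pub-hodgecm-pv08-g3-0, unit pub-hodgecm-pv08-g3).
WIP module `Pv08g3.S4ModelSeparation`; proposed final place `HodgeCM/PerL34/S4ModelSeparation.lean`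
(module `HodgeCM.PerL34.S4ModelSeparation`).  Imports this seat's `Pv08g3.S4Strength` (run 23 ↦
`HodgeCM.PerL34.S4Strength`; LANDS AFTER IT) and the LANDED `HodgeCM.Model.ThetaSeparation` (`exists_goodCtx`) and
`HodgeCM.Literature.NormTheoremHolds` (`lemma33bLandherr_holds`, KERNEL since run 22) only.  Nothing is posited, nothing is cited; no mathematics of [PerL]
is proved or refuted here.

`S4ModelSeparation`: the MODEL-LEVEL form of the separating instance of `S4Strength` §(2).  There the witness was a
single isolation core (`SmokeS4.core`, not of the form `T.core V c`); here it is a whole `U.ThetaModel`: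

  for every theta model `T` there is a theta model `T.smokeArch` with THE SAME good contexts, theta classes `Theta`,
  coverings, sign data (`kappa`, `frameSign`) — hence the same truth value of every open input that reads only those
  (`Open_thetaWedge`, checked below) — whose archimedean data `(H, CG, G, SK, SigIdx, core, t12, t34)` are the Prior
  one-point smoke objects, so that
    (a) `T.smokeArch.Open_occ` holds                                   (`smokeArch_open_occ`; the leaf is `True`),
    (b) for EVERY choice of pointed extensions `Pc`, the S4 binder
        `∀ V c, GoodCtx → Nonempty (ArchCDatum (core V c) (t12 V c) (Pc V c))` FAILS at every good context
                                                                        (`smokeArch_binder_false`).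
  Hence (`archC_binder_not_conservative`): as soon as some theta model has some good context, there is a theta model
  on which `Open_occ` holds and the `A12` (= `A34`) binder of `Open_occ_of_archC` fails for every `Pc` — the binder is
  NOT CONSERVATIVE over the open input AT MODEL LEVEL, not merely per core.  (The two hypotheses are the honest
  non-vacuity conditions: without a theta model or without a good context every `∀ good ctx, …` statement is vacuous.)
  In the cell's established idiom (`Model/ThetaSeparation.lean`: `separating_thetaWedge (A : T.Inputs) (hL)` etc.) the
  good context comes from the two DESIGN constraints alone — `ThetaSeparation.exists_goodCtx hκ hs lemma33bLandherr_holds`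
  (Landherr / L3.3(b) is KERNEL since run 22) — giving the design-conditional form `separating_occBinder (hκ) (hs)`:
  for EVERY theta model `T` meeting its design constraints, `T.smokeArch ⊨ Open_occ` and the binder fails on it.

Scope note (my words): this says nothing about the INTENDED model, where the D-free core set-up holds for elementary
reasons (`S4Strength` §(3)); it says that the typed cone cannot derive the h29 binder from `Open_occ`, i.e. that
'N29 fed by name' carries the existence of the analytic core as extra content.
-/
import Summits.HodgeConjecture.HodgeCM.PerL34.S4Strength_2
import Summits.HodgeConjecture.HodgeCM.Model.ThetaSeparation
import Summits.HodgeConjecture.HodgeCM.Literature.NormTheoremHolds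

/-! PORT of `HodgeCM/PerL34/S4ModelSeparation.lean` (HodgeCMPerL run 82) — verbatim mechanical port; provenance in the PORT header line. -/

set_option autoImplicit false

noncomputable section

namespace HodgeCM
namespace Universe.ThetaModel

open HodgeCM.Prior.Perl34File HodgeCM.Prior.Perl34File.Perl34 HodgeCM.PerL34.ArchC

variable {U : Universe} (T : U.ThetaModel)

/-- **The archimedean-smoke modification of a theta model**: same `HG`-free global data (`Theta`, `cover`, `kappa`,
`frameSign`), archimedean data := the Prior one-point smoke (`H = HG = CG = ℂ`, `G = SK = SigIdx = SigIdxG = Unit`,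
`core := SmokeS4.core`, both torus sides `:= SmokeS4.torus`), `emb := 0`. -/
def smokeArch : U.ThetaModel :=
  { T with
    HG := fun _ _ _ => ℂ
    instHG₁ := fun _ _ _ => inferInstance
    instHG₂ := fun _ _ _ => inferInstance
    instHG₃ := fun _ _ _ => inferInstance
    emb := fun _ => 0
    H := fun _ _ => ℂ
    CG := fun _ _ => ℂ
    G := fun _ _ => Unit
    SK := fun _ _ => Unit
    SigIdx := fun _ _ => Unit
    SigIdxG := fun _ _ => Unit
    instH₁ := fun _ _ => inferInstance
    instH₂ := fun _ _ => inferInstance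
    instH₃ := fun _ _ => inferInstance
    instCG₁ := fun _ _ => inferInstance
    instCG₂ := fun _ _ => inferInstance
    instG₁ := fun _ _ => inferInstance
    instG₂ := fun _ _ => inferInstance
    instSK := fun _ _ => inferInstance
    core := fun _ _ => SmokeS4.core
    t12 := fun _ _ => SmokeS4.torus
    t34 := fun _ _ => SmokeS4.torus }

/-- Good contexts are unchanged (they read only `kappa` and `frameSign`). -/
theorem smokeArch_goodCtx_iff {L : CMField} (ι₁ : L →+* ℂ) (c : SeesawCtx L) :
    T.smokeArch.GoodCtx ι₁ c ↔ T.GoodCtx ι₁ c :=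
  ⟨fun h => ⟨h.pairSum, h.injective, h.mem, h.forced⟩, fun h => ⟨h.pairSum, h.injective, h.mem, h.forced⟩⟩

/-- Theta classes are unchanged. -/
theorem smokeArch_Theta {L : CMField} {ι₁ : L →+* ℂ} (V : HermSpace3 L ι₁) (c : SeesawCtx L) (i : Fin 4)
    (Γ : Level V) : T.smokeArch.Theta V c i Γ = T.Theta V c i Γ := rfl

/-- … hence so is the open input `Open_thetaWedge` (node N33), for instance. -/
theorem smokeArch_open_thetaWedge_iff : T.smokeArch.Open_thetaWedge ↔ T.Open_thetaWedge := by
  constructor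
  · intro h L ι₁ V c hc
    exact h V c ((T.smokeArch_goodCtx_iff ι₁ c).mpr hc)
  · intro h L ι₁ V c hc
    exact h V c ((T.smokeArch_goodCtx_iff ι₁ c).mp hc)

/-- **(a)** `Open_occ` holds on the modified model: both torus sides have `wOccurs ≡ True`. -/
theorem smokeArch_open_occ : T.smokeArch.Open_occ := by
  intro L ι₁ V c _
  exact ⟨fun _ _ _ => trivial, fun _ _ _ => trivial⟩

/-- **(b)** the S4 binder fails on the modified model at every good context, for every pointed extension. -/
theorem smokeArch_binder_false
    (Pc : ∀ {L : CMField} {ι₁ : L →+* ℂ} (V : HermSpace3 L ι₁) (c : SeesawCtx L),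
      C4a.PointedCore (T.smokeArch.core V c))
    {L : CMField} {ι₁ : L →+* ℂ} (V : HermSpace3 L ι₁) (c : SeesawCtx L) (hc : T.GoodCtx ι₁ c) :
    ¬ (∀ {L : CMField} {ι₁ : L →+* ℂ} (V : HermSpace3 L ι₁) (c : SeesawCtx L),
        T.smokeArch.GoodCtx ι₁ c →
          Nonempty (ArchCDatum (T.smokeArch.core V c) (T.smokeArch.t12 V c) (Pc V c))) := by
  intro h
  obtain ⟨A⟩ := h V c ((T.smokeArch_goodCtx_iff ι₁ c).mpr hc)
  exact (isEmpty_archCDatum_smoke SmokeS4.torus (Pc V c)).false A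

/-- The same for the (34) side. -/
theorem smokeArch_binder34_false
    (Pc : ∀ {L : CMField} {ι₁ : L →+* ℂ} (V : HermSpace3 L ι₁) (c : SeesawCtx L),
      C4a.PointedCore (T.smokeArch.core V c))
    {L : CMField} {ι₁ : L →+* ℂ} (V : HermSpace3 L ι₁) (c : SeesawCtx L) (hc : T.GoodCtx ι₁ c) :
    ¬ (∀ {L : CMField} {ι₁ : L →+* ℂ} (V : HermSpace3 L ι₁) (c : SeesawCtx L),
        T.smokeArch.GoodCtx ι₁ c →
          Nonempty (ArchCDatum (T.smokeArch.core V c) (T.smokeArch.t34 V c) (Pc V c))) :=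
  T.smokeArch_binder_false Pc V c hc

/-- Pointed extensions of the modified model exist (so (b) is not about an empty `Pc` type). -/
theorem smokeArch_pointedCores :
    Nonempty (∀ {L : CMField} {ι₁ : L →+* ℂ} (V : HermSpace3 L ι₁) (c : SeesawCtx L),
      C4a.PointedCore (T.smokeArch.core V c)) :=
  ⟨fun _ _ => SmokeS4.pointed⟩

/-- **The S4 binder is not conservative over `Open_occ` at model level.**  If some theta model has some good
context, then some theta model satisfies `Open_occ` while the `A12` binder of `Open_occ_of_archC` fails for EVERY
family of pointed extensions (and such families exist). -/
theorem archC_binder_not_conservative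
    (hex : ∃ (T : U.ThetaModel) (L : CMField) (ι₁ : L →+* ℂ) (_V : HermSpace3 L ι₁) (c : SeesawCtx L),
      T.GoodCtx ι₁ c) :
    ∃ T' : U.ThetaModel, T'.Open_occ ∧
      Nonempty (∀ {L : CMField} {ι₁ : L →+* ℂ} (V : HermSpace3 L ι₁) (c : SeesawCtx L),
        C4a.PointedCore (T'.core V c)) ∧
      ∀ Pc : (∀ {L : CMField} {ι₁ : L →+* ℂ} (V : HermSpace3 L ι₁) (c : SeesawCtx L),
          C4a.PointedCore (T'.core V c)),
        ¬ (∀ {L : CMField} {ι₁ : L →+* ℂ} (V : HermSpace3 L ι₁) (c : SeesawCtx L),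
            T'.GoodCtx ι₁ c → Nonempty (ArchCDatum (T'.core V c) (T'.t12 V c) (Pc V c))) := by
  obtain ⟨T, L, ι₁, V, c, hc⟩ := hex
  exact ⟨T.smokeArch, T.smokeArch_open_occ, T.smokeArch_pointedCores, fun Pc => T.smokeArch_binder_false Pc V c hc⟩

/-- **Separating model for the S4 binder, design-conditional form** (the idiom of `Model/ThetaSeparation.lean`):
for every theta model meeting its two DESIGN constraints (`Design_kappaConj`, `Design_frameSignConj` — F3 of the
carver's frontier, discharged by the instance), the modified model `T.smokeArch` satisfies `Open_occ` and refutes the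
`A12` binder of `Open_occ_of_archC` for every family of pointed extensions; the good context is supplied by
`exists_goodCtx` with Landherr's L3.3(b) KERNEL (`lemma33bLandherr_holds`). -/
theorem separating_occBinder (hκ : T.Design_kappaConj) (hs : T.Design_frameSignConj) :
    T.smokeArch.Open_occ ∧
      (T.smokeArch.Open_thetaWedge ↔ T.Open_thetaWedge) ∧
      ∀ Pc : (∀ {L : CMField} {ι₁ : L →+* ℂ} (V : HermSpace3 L ι₁) (c : SeesawCtx L),
          C4a.PointedCore (T.smokeArch.core V c)),
        ¬ (∀ {L : CMField} {ι₁ : L →+* ℂ} (V : HermSpace3 L ι₁) (c : SeesawCtx L),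
            T.smokeArch.GoodCtx ι₁ c →
              Nonempty (ArchCDatum (T.smokeArch.core V c) (T.smokeArch.t12 V c) (Pc V c))) := by
  obtain ⟨L, ι₁, V, c, hc⟩ := exists_goodCtx T hκ hs lemma33bLandherr_holds
  exact ⟨T.smokeArch_open_occ, T.smokeArch_open_thetaWedge_iff, fun Pc => T.smokeArch_binder_false Pc V c hc⟩

end Universe.ThetaModel
end HodgeCM

end
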